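import Literature.Probability.RandomPlanarGeometry.SchrammWilsonClock
import Literature.Probability.RandomPlanarGeometry.RadialChordalTrace
import Literature.Probability.RandomPlanarGeometry.RadialBesselMPTransfer
import Literature.Probability.RandomPlanarGeometry.SLESimpleTraceGeneralBM
import Literature.Probability.Process.MartingaleClockTimeChange
import Literature.Probability.Process.BrownianConcatenation
import HarnessLib

/-!
# Radial SLE_κ is locally generated by a curve (κ ≠ 8), via the Schramm–Wilson pull-back

Topic `Probability/RandomPlanarGeometry`; definitions with bodies and proved theorems only (no
named fact). **Main theorems** (`RadialSLE.ae_of_chordal`, the abstract transfer of a.s. properties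
of the chordal trace to the radial chain of every Brownian motion; `RadialSLE.ae_locallyGenerated`;
and `RadialSLE.ae_locallyGeneratedSimple`, the simple phase `κ ≤ 4` where the radial curve stays in
the open disc, chordal input `ae_isSimpleTrace_of_isBrownianReal`): for every real Brownian motion
`B` with continuous paths (`B₀ = 0`) on any probability space and every `κ ∉ {0, 8}`, almost surely
the radial Loewner chain of `V = √κ B` (`RadialLoewner.Disc`, driving point `e^{iV}`) is generated
by a continuous curve `η` with tips — `𝔻 ∖ K_u` is the component of `0` in `𝔻 ∖ η[0, u]` and
`g_u⁻¹(r e^{iV_u}) → η_u` as `r ↑ 1` (`RadialSLE.LocallyGenerated`) — up to the radial horizon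
`ρ = S ∧ T` (`RadialSLE.horizon`), where `S` is the exit time of the level-`n` stopped angle of the
marked boundary point `-1` from `(2ε, 2π − 2ε)`. This is Lawler (2005), Prop. 6.21 / Rohde–Schramm's
radial remark, proved here by the Schramm–Wilson coordinate change instead of re-running the
derivative estimates in the disc:

1. the stopped radial Bessel flow `Y` of the marked point solves the `(κ, 0)` angle martingale
   problem for every Brownian motion (`RadialLoewner.martingale_angleMP_bmFlow`);
2. exponential tilting to `(κ, κ − 6)` (`exists_tilted_measure_target`, `Q ~ P`);
3. under `Q`, the chordal driver `W = R + 𝒴 cot(Y/2)` has the martingale clock `κ τ`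
   (`SchrammWilson.hasMartingaleClock_swMart`);
4. time change by the inverse clock (`HasMartingaleClock.timeChange`) and concatenation with an
   independent Brownian motion (`isBrownianReal_concat`) produce `√κ ×` a Brownian motion on
   `Ω × C` that agrees with the pathwise chordal driver `RadialChordal.cdrv` up to the clock of `ρ`
   (`RadialSLE.driver_agree`, from `tcProc_clock`, `concat_eq_of_le` and the identification of the
   Schramm–Wilson processes with the pathwise data, `SchrammWilson.wProc_eq_drv` etc.);
5. its chordal chain is generated by a curve almost surely (`ae_isGeneratedByCurve_of_isBrownianReal`,
   Rohde–Schramm Thm. 5.1 for a general Brownian motion, `κ ≠ 8`), hence the radial chain is locally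
   generated (`RadialChordal.radialTrace_of_isGeneratedByCurve`, `RadialSLE.locallyGenerated_of_agree`);
6. the conclusion involves only `ω`, so it transfers from `Q ⊗ W`-a.e. to `Q`-a.e.
   (`Measure.ae_ae_of_ae_prod`) and to `P`-a.e. (`P ≪ Q`).

Also: progressivity/continuity of the Schramm–Wilson processes (`SchrammWilson.isStronglyProgressive_swMart`,
`continuous_swMart`, `strictMonoOn_clockProc`, …) and the radial Bessel equation of the sample path
up to the band exit (`RadialSLE.flow_eq_integral`, `bandExit_le_exitLevel`).

## References

* O. Schramm, D. B. Wilson, *SLE coordinate changes*, New York J. Math. 11 (2005), §4 Thm. 3.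
  [SchrammWilson2005]
* G. F. Lawler, *Conformally Invariant Processes in the Plane*, AMS (2005), §4.6.3, §6.5
  (Prop. 6.21). [Lawler2005]
* S. Rohde, O. Schramm, *Basic properties of SLE*, Ann. of Math. 161 (2005), Thm. 5.1.
  [RohdeSchramm2005]
* D. Revuz, M. Yor, *Continuous Martingales and Brownian Motion* (1999), Ch. V Thm. (1.6), (1.7).
  [RevuzYor1999]
-/


noncomputable section

open MeasureTheory Filter Set Function Metric
open scoped NNReal ENNReal Topology Real

namespace Literature.Probability.RandomPlanarGeometry

namespace SchrammWilson

open Literature.Probability.Process Literature.Analysis.FunctionSpaces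

variable {Ω : Type*} {m : MeasurableSpace Ω} {𝓕 : Filtration ℝ≥0 m} {X : ℝ≥0 → Ω → ℝ} {a ε : ℝ} {T : ℝ≥0}
  {κ : ℝ≥0}

/-! ### Progressive measurability -/

section Prog

variable (hX : IsStronglyProgressive 𝓕 X) (ha : 0 < a) (ha' : a ≤ π)
include hX ha ha'

/-- `𝒴` is progressive. [folklore] -/
theorem isStronglyProgressive_yProc (T : ℝ≥0) : IsStronglyProgressive 𝓕 (yProc a T X) :=
  IsStronglyProgressive.continuous_comp
    (isStronglyProgressive_timeIntegral
      ((IsStronglyProgressive.continuous_comp hX (continuous_qfc ha ha')).indicator_le_const T))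
    (Real.continuous_exp.comp continuous_neg)

/-- `R` is progressive. [folklore] -/
theorem isStronglyProgressive_rProc (T : ℝ≥0) : IsStronglyProgressive 𝓕 (rProc a T X) :=
  isStronglyProgressive_timeIntegral
    (((isStronglyProgressive_yProc hX ha ha' T).mul
      (IsStronglyProgressive.continuous_comp hX (continuous_pfc ha ha'))).indicator_le_const T)

/-- `W` is progressive. [folklore] -/
theorem isStronglyProgressive_wProc (T : ℝ≥0) : IsStronglyProgressive 𝓕 (wProc a T X) :=
  (isStronglyProgressive_rProc hX ha ha' T).add
    ((isStronglyProgressive_yProc hX ha ha' T).mul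
      (IsStronglyProgressive.continuous_comp (hX.min_const T) (continuous_cotc ha ha')))

/-- The clock is progressive. [folklore] -/
theorem isStronglyProgressive_clockProc (T : ℝ≥0) : IsStronglyProgressive 𝓕 (clockProc a T X) :=
  isStronglyProgressive_timeIntegral
    (((IsStronglyProgressive.continuous_comp (isStronglyProgressive_yProc hX ha ha' T) (continuous_pow 2)).mul
      (IsStronglyProgressive.continuous_comp
        (IsStronglyProgressive.continuous_comp hX (continuous_qfc ha ha')) (continuous_pow 2))).indicator_le_const T)

/-- The normalised increment is progressive. [folklore] -/
theorem isStronglyProgressive_swMart (κ : ℝ≥0) (T : ℝ≥0) : IsStronglyProgressive 𝓕 (swMart κ a T X) :=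
  IsStronglyProgressive.continuous_comp
    ((isStronglyProgressive_wProc hX ha ha' T).sub (isStronglyProgressive_wProc hX ha ha' T).initial)
    (continuous_id.div_const _)

end Prog

/-! ### Path representations -/

section Paths

variable (ha : 0 < a) (ha' : a ≤ π)

/-- `𝒴_t = exp(-∫₀^{t∧T} q(X_u) du)` as a path integral. [folklore] -/
theorem yProc_eq (t : ℝ≥0) (ω : Ω) :
    yProc a T X t ω = Real.exp (-∫ u in (0 : ℝ)..((min t T : ℝ≥0) : ℝ), qfc a (X u.toNNReal ω)) := by
  simp only [yProc]
  rw [show qKill a T X = fun s ω ↦ if s ≤ T then (fun s ω ↦ qfc a (X s ω)) s ω else 0 from rfl,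
    timeIntegral_killed_eq (fun u _ _ ↦ rfl)]

/-- `𝒴` at a real time `≤ T`. [folklore] -/
theorem yProc_toNNReal_eq {u : ℝ} (hu0 : 0 ≤ u) (huT : u ≤ T) (ω : Ω) :
    yProc a T X u.toNNReal ω = Real.exp (-∫ v in (0 : ℝ)..u, qfc a (X v.toNNReal ω)) := by
  rw [yProc_eq, min_eq_left (Real.toNNReal_le_iff_le_coe.2 huT), Real.coe_toNNReal _ hu0]

include ha ha' in
/-- `𝒴` has continuous paths. [folklore] -/
theorem continuous_yProc (hXc : ∀ ω, Continuous (X · ω)) (ω : Ω) : Continuous fun t ↦ yProc a T X t ω := by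
  have hc : Continuous fun u : ℝ ↦ qfc a (X u.toNNReal ω) :=
    (continuous_qfc ha ha').comp ((hXc ω).comp continuous_real_toNNReal)
  have heq : (fun t ↦ yProc a T X t ω) =
      (fun r : ℝ ↦ Real.exp (-∫ u in (0 : ℝ)..r, qfc a (X u.toNNReal ω))) ∘
        fun t : ℝ≥0 ↦ ((min t T : ℝ≥0) : ℝ) := by
    funext t; exact yProc_eq t ω
  rw [heq]
  exact (Real.continuous_exp.comp (continuous_primitive' hc).neg).comp
    (NNReal.continuous_coe.comp (continuous_id.min continuous_const))

/-- `R_t = ∫₀^{t∧T} 𝒴_u p(X_u) du` as a path integral. [folklore] -/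
theorem rProc_eq (t : ℝ≥0) (ω : Ω) :
    rProc a T X t ω = ∫ u in (0 : ℝ)..((min t T : ℝ≥0) : ℝ),
      Real.exp (-∫ v in (0 : ℝ)..u, qfc a (X v.toNNReal ω)) * pfc a (X u.toNNReal ω) := by
  simp only [rProc]
  rw [show pKill a T X = fun s ω ↦ if s ≤ T then (fun s ω ↦ yProc a T X s ω * pfc a (X s ω)) s ω else 0 from rfl,
    timeIntegral_killed_eq (fun u hu0 huT ↦ by
      show yProc a T X u.toNNReal ω * pfc a (X u.toNNReal ω) = _
      rw [yProc_toNNReal_eq hu0 huT])]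

/-- The clock as a path integral. [folklore] -/
theorem clockProc_eq (t : ℝ≥0) (ω : Ω) :
    clockProc a T X t ω = ∫ u in (0 : ℝ)..((min t T : ℝ≥0) : ℝ),
      Real.exp (-∫ v in (0 : ℝ)..u, qfc a (X v.toNNReal ω)) ^ 2 * qfc a (X u.toNNReal ω) ^ 2 := by
  simp only [clockProc]
  rw [show cKill a T X = fun s ω ↦ if s ≤ T then (fun s ω ↦ yProc a T X s ω ^ 2 * qfc a (X s ω) ^ 2) s ω else 0
      from rfl,
    timeIntegral_killed_eq (fun u hu0 huT ↦ by
      show yProc a T X u.toNNReal ω ^ 2 * qfc a (X u.toNNReal ω) ^ 2 = _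
      rw [yProc_toNNReal_eq hu0 huT])]

/-- The clock is frozen after `T`. [folklore] -/
theorem clockProc_eq_min (t : ℝ≥0) (ω : Ω) : clockProc a T X t ω = clockProc a T X (min t T) ω := by
  rw [clockProc_eq, clockProc_eq, min_assoc, min_self]

include ha ha' in
/-- `R` has continuous paths. [folklore] -/
theorem continuous_rProc (hXc : ∀ ω, Continuous (X · ω)) (ω : Ω) : Continuous fun t ↦ rProc a T X t ω := by
  have hq : Continuous fun u : ℝ ↦ qfc a (X u.toNNReal ω) :=
    (continuous_qfc ha ha').comp ((hXc ω).comp continuous_real_toNNReal)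
  have hp : Continuous fun u : ℝ ↦ pfc a (X u.toNNReal ω) :=
    (continuous_pfc ha ha').comp ((hXc ω).comp continuous_real_toNNReal)
  have hy : Continuous fun r : ℝ ↦ Real.exp (-∫ u in (0 : ℝ)..r, qfc a (X u.toNNReal ω)) :=
    Real.continuous_exp.comp (continuous_primitive' hq).neg
  have heq : (fun t ↦ rProc a T X t ω) =
      (fun r : ℝ ↦ ∫ u in (0 : ℝ)..r, Real.exp (-∫ v in (0 : ℝ)..u, qfc a (X v.toNNReal ω)) * pfc a (X u.toNNReal ω)) ∘
        fun t : ℝ≥0 ↦ ((min t T : ℝ≥0) : ℝ) := by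
    funext t; exact rProc_eq t ω
  rw [heq]
  exact (continuous_primitive' (hy.mul hp)).comp (NNReal.continuous_coe.comp (continuous_id.min continuous_const))

include ha ha' in
/-- The clock has continuous paths. [folklore] -/
theorem continuous_clockProc (hXc : ∀ ω, Continuous (X · ω)) (ω : Ω) : Continuous fun t ↦ clockProc a T X t ω := by
  have hq : Continuous fun u : ℝ ↦ qfc a (X u.toNNReal ω) :=
    (continuous_qfc ha ha').comp ((hXc ω).comp continuous_real_toNNReal)
  have hy : Continuous fun r : ℝ ↦ Real.exp (-∫ u in (0 : ℝ)..r, qfc a (X u.toNNReal ω)) :=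
    Real.continuous_exp.comp (continuous_primitive' hq).neg
  have heq : (fun t ↦ clockProc a T X t ω) =
      (fun r : ℝ ↦ ∫ u in (0 : ℝ)..r, Real.exp (-∫ v in (0 : ℝ)..u, qfc a (X v.toNNReal ω)) ^ 2 *
          qfc a (X u.toNNReal ω) ^ 2) ∘ fun t : ℝ≥0 ↦ ((min t T : ℝ≥0) : ℝ) := by
    funext t; exact clockProc_eq t ω
  rw [heq]
  exact (continuous_primitive' ((hy.pow 2).mul (hq.pow 2))).comp
    (NNReal.continuous_coe.comp (continuous_id.min continuous_const))

include ha ha' in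
/-- **The clock is strictly increasing on `[0, T]`** (its rate `𝒴² q² > 0`). [folklore] -/
theorem strictMonoOn_clockProc (hXc : ∀ ω, Continuous (X · ω)) (ω : Ω) :
    StrictMonoOn (fun t ↦ clockProc a T X t ω) (Icc 0 T) := by
  intro s hs t ht hst
  have hq : Continuous fun u : ℝ ↦ qfc a (X u.toNNReal ω) :=
    (continuous_qfc ha ha').comp ((hXc ω).comp continuous_real_toNNReal)
  have hy : Continuous fun r : ℝ ↦ Real.exp (-∫ u in (0 : ℝ)..r, qfc a (X u.toNNReal ω)) :=
    Real.continuous_exp.comp (continuous_primitive' hq).neg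
  set g : ℝ → ℝ := fun u ↦ Real.exp (-∫ v in (0 : ℝ)..u, qfc a (X v.toNNReal ω)) ^ 2 * qfc a (X u.toNNReal ω) ^ 2
  have hg : Continuous g := (hy.pow 2).mul (hq.pow 2)
  have hgpos : ∀ u, 0 < g u := fun u ↦ mul_pos (pow_pos (Real.exp_pos _) 2) (pow_pos (qfc_pos ha ha' _) 2)
  show clockProc a T X s ω < clockProc a T X t ω
  rw [clockProc_eq, clockProc_eq, min_eq_left hs.2, min_eq_left ht.2]
  have hst' : (s : ℝ) < t := NNReal.coe_lt_coe.2 hst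
  rw [← intervalIntegral.integral_add_adjacent_intervals (hg.intervalIntegrable 0 s) (hg.intervalIntegrable s t)]
  have hpos : 0 < ∫ u in (s : ℝ)..t, g u :=
    intervalIntegral.intervalIntegral_pos_of_pos_on (hg.intervalIntegrable _ _) (fun u _ ↦ hgpos u) hst'
  linarith

include ha ha' in
/-- `W` has continuous paths. [folklore] -/
theorem continuous_wProc (hXc : ∀ ω, Continuous (X · ω)) (ω : Ω) : Continuous fun t ↦ wProc a T X t ω :=
  (continuous_rProc ha ha' hXc ω).add ((continuous_yProc ha ha' hXc ω).mul
    ((continuous_cotc ha ha').comp ((hXc ω).comp (continuous_id.min continuous_const))))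

include ha ha' in
/-- The normalised increment has continuous paths. [folklore] -/
theorem continuous_swMart (hXc : ∀ ω, Continuous (X · ω)) (ω : Ω) : Continuous fun t ↦ swMart κ a T X t ω :=
  ((continuous_wProc ha ha' hXc ω).sub continuous_const).div_const _

/-- `W₀ = cot(X₀/2)`; in particular `W₀ = 0` when `X₀ = π`. [folklore] -/
theorem wProc_zero_of_eq_pi (ha' : a ≤ π) {ω : Ω} (h0 : X 0 ω = π) : wProc a T X 0 ω = 0 := by
  have hπ : (π : ℝ) ∈ Icc a (2 * π - a) := ⟨ha', by linarith⟩
  have hmin : min (0 : ℝ≥0) T = 0 := min_eq_left (show (0 : ℝ≥0) ≤ T from bot_le)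
  simp only [wProc, rProc, yProc, timeIntegral_apply_zero, hmin, h0]
  rw [cotc_of_mem hπ, Real.cot_pi_div_two]
  simp

/-- The processes are frozen after `T`: `W_t = W_{t ∧ T}`. [folklore] -/
theorem wProc_eq_min (t : ℝ≥0) (ω : Ω) : wProc a T X t ω = wProc a T X (min t T) ω := by
  simp only [wProc]
  rw [rProc_eq, rProc_eq, yProc_eq, yProc_eq, min_assoc, min_self]

/-- `swMart_t = swMart_{t ∧ T}`. [folklore] -/
theorem swMart_eq_min (t : ℝ≥0) (ω : Ω) : swMart κ a T X t ω = swMart κ a T X (min t T) ω := by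
  simp only [swMart]
  rw [wProc_eq_min t ω]

end Paths

/-! ### Identification with the pathwise Schramm–Wilson data -/

section Identification

variable {ω : Ω} {u₁ : ℝ} (hband : ∀ s, X s ω ∈ Icc a (2 * π - a)) (hu₁T : u₁ ≤ T)
include hband hu₁T

omit hband hu₁T in
/-- The clamped path of `RadialChordal` is the path. [folklore] -/
theorem Ycl_path {s : ℝ} (hs : s ∈ Icc 0 u₁) :
    RadialChordal.Ycl (fun u ↦ X u.toNNReal ω) u₁ s = X s.toNNReal ω := by
  rw [RadialChordal.Ycl, RadialChordal.clampT_of_mem hs]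

/-- **`𝒴 = imP`** on `[0, u₁]`. [cite: SchrammWilson2005, §4] -/
theorem yProc_eq_imP {u : ℝ} (hu : u ∈ Icc 0 u₁) :
    yProc a T X u.toNNReal ω = RadialChordal.imP (fun u ↦ X u.toNNReal ω) u₁ u := by
  rw [yProc_toNNReal_eq hu.1 (hu.2.trans hu₁T), RadialChordal.imP]
  congr 2
  refine intervalIntegral.integral_congr fun v hv ↦ ?_
  rw [uIcc_of_le hu.1] at hv
  have hv' : v ∈ Icc 0 u₁ := ⟨hv.1, hv.2.trans hu.2⟩
  show qfc a (X v.toNNReal ω) = 1 / (2 * Real.sin (RadialChordal.Ycl (fun u ↦ X u.toNNReal ω) u₁ v / 2) ^ 2)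
  rw [Ycl_path hv', qfc_of_mem (hband _), qf]

/-- **`R = reP`** on `[0, u₁]`. [cite: SchrammWilson2005, §4] -/
theorem rProc_eq_reP {u : ℝ} (hu : u ∈ Icc 0 u₁) :
    rProc a T X u.toNNReal ω = RadialChordal.reP (fun u ↦ X u.toNNReal ω) u₁ u := by
  rw [rProc_eq, min_eq_left (Real.toNNReal_le_iff_le_coe.2 (hu.2.trans hu₁T)), Real.coe_toNNReal _ hu.1,
    RadialChordal.reP, ← intervalIntegral.integral_neg]
  refine intervalIntegral.integral_congr fun v hv ↦ ?_
  rw [uIcc_of_le hu.1] at hv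
  have hv' : v ∈ Icc 0 u₁ := ⟨hv.1, hv.2.trans hu.2⟩
  show Real.exp (-∫ w in (0 : ℝ)..v, qfc a (X w.toNNReal ω)) * pfc a (X v.toNNReal ω) = _
  rw [← yProc_toNNReal_eq hv.1 (hv'.2.trans hu₁T), yProc_eq_imP hband hu₁T hv', Ycl_path hv',
    pfc_of_mem (hband _), pf]
  ring

/-- **The clocks agree** on `[0, u₁]`. [cite: SchrammWilson2005, §4] -/
theorem clockProc_eq_clock {u : ℝ} (hu : u ∈ Icc 0 u₁) :
    clockProc a T X u.toNNReal ω = RadialChordal.clock (fun u ↦ X u.toNNReal ω) u₁ u := by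
  rw [clockProc_eq, min_eq_left (Real.toNNReal_le_iff_le_coe.2 (hu.2.trans hu₁T)), Real.coe_toNNReal _ hu.1,
    RadialChordal.clock]
  refine intervalIntegral.integral_congr fun v hv ↦ ?_
  rw [uIcc_of_le hu.1] at hv
  have hv' : v ∈ Icc 0 u₁ := ⟨hv.1, hv.2.trans hu.2⟩
  show Real.exp (-∫ w in (0 : ℝ)..v, qfc a (X w.toNNReal ω)) ^ 2 * qfc a (X v.toNNReal ω) ^ 2 = _
  rw [← yProc_toNNReal_eq hv.1 (hv'.2.trans hu₁T), yProc_eq_imP hband hu₁T hv', Ycl_path hv',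
    qfc_of_mem (hband _), qf]
  ring

/-- **`W = drv`** on `[0, u₁]`. [cite: SchrammWilson2005, §4 Thm. 3] -/
theorem wProc_eq_drv {u : ℝ} (hu : u ∈ Icc 0 u₁) :
    wProc a T X u.toNNReal ω = RadialChordal.drv (fun u ↦ X u.toNNReal ω) u₁ u := by
  simp only [wProc, RadialChordal.drv]
  rw [min_eq_left (Real.toNNReal_le_iff_le_coe.2 (hu.2.trans hu₁T)), rProc_eq_reP hband hu₁T hu,
    yProc_eq_imP hband hu₁T hu, Ycl_path hu, cotc_of_mem (hband _)]

end Identification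

end SchrammWilson

/-! ## The radial trace theorem (assembly) -/

namespace RadialSLE

open SchrammWilson RadialLoewner Literature.Probability.Process Literature.Analysis.FunctionSpaces Complex ProbabilityTheory

variable {Ω : Type*} {mΩ : MeasurableSpace Ω} {P : Measure Ω} {B : ℝ≥0 → Ω → ℝ} {κ : ℝ≥0}

/-- **Local generation by a curve, with tips**: the radial Loewner chain of the driving function
`V` (`e^{iV}`) is generated by a continuous curve `η` (`η₀ = 1`, `|η| ≤ 1`) up to every radial
time `u₂ < u₁` — the complement of the hull is the component of `0` in `𝔻 ∖ η[0, u]` and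
`g_u⁻¹(r e^{iV_u}) → η_u` as `r ↑ 1`. [cite: Lawler2005, §6.5] -/
def LocallyGenerated (V : ℝ≥0 → ℝ) (u₁ : ℝ) : Prop :=
  ∀ u₂ : ℝ≥0, (u₂ : ℝ) < u₁ → ∃ η : ℝ≥0 → ℂ, Continuous η ∧ η 0 = 1 ∧ (∀ s, ‖η s‖ ≤ 1) ∧
    ∀ u : ℝ≥0, u ≤ u₂ →
      RadialLoewner.Disc.domain V u = connectedComponentIn (ball (0 : ℂ) 1 \ η '' Icc 0 u) 0 ∧
      Tendsto (fun r : ℝ ↦ Function.invFunOn (RadialLoewner.Disc.map V u) (RadialLoewner.Disc.domain V u)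
          ((r : ℂ) * Complex.exp ((V u : ℝ) * I)))
        (𝓝[<] 1) (𝓝 (η u))

/-- **Deterministic reduction**: the Schramm–Wilson data of an angle path `Y` and the generation
of the chordal chain of any continuous driver agreeing with `cdrv Y u₁` up to the clock of `u₁`
give local generation of the radial chain up to `u₁` (`RadialChordal.radialTrace_of_isGeneratedByCurve`).
[cite: SchrammWilson2005, §4] -/
theorem locallyGenerated_of_agree {Y : ℝ → ℝ} {u₁ : ℝ} {V : ℝ≥0 → ℝ} (hu₁ : 0 ≤ u₁)
    (hY : ContinuousOn Y (Icc 0 u₁)) (hYI : ∀ u ∈ Icc 0 u₁, Y u ∈ Ioo 0 (2 * π))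
    (hV : Continuous V) (hV0 : V 0 = 0)
    (hYeq : ∀ u ∈ Icc 0 u₁, Y u = π + (∫ s in (0 : ℝ)..u, Real.cot (Y s / 2)) - V u.toNNReal)
    {Wt : ℝ≥0 → ℝ} (hWt : Continuous Wt)
    (hagree : ∀ s : ℝ≥0, (s : ℝ) ≤ RadialChordal.clock Y u₁ u₁ → Wt s = RadialChordal.cdrv Y u₁ s)
    {γ : ℝ≥0 → ℂ} (hγ : Loewner.IsGeneratedByCurve Wt γ) : LocallyGenerated V u₁ := by
  intro u₂ hu₂
  refine ⟨_, RadialChordal.radialTrace_of_isGeneratedByCurve hu₁ hY hYI hV hV0 hYeq hu₂ hWt (fun s hs ↦ hagree s ?_) hγ⟩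
  have h1 : (s : ℝ) ≤ RadialChordal.clock Y u₁ u₂ := by
    rw [← RadialChordal.coe_clockNN hu₁ hY hYI]; exact_mod_cast hs
  exact h1.trans ((RadialChordal.strictMono_clock hu₁ hY hYI).monotone hu₂.le)

/-- **Local generation by a curve that stays inside the disc** (the simple phase): as
`LocallyGenerated`, and moreover `|η_s| < 1` for `0 < s` (when `0 < u₂`). [cite: Lawler2005, §6.5] -/
def LocallyGeneratedSimple (V : ℝ≥0 → ℝ) (u₁ : ℝ) : Prop :=
  ∀ u₂ : ℝ≥0, (u₂ : ℝ) < u₁ → ∃ η : ℝ≥0 → ℂ, Continuous η ∧ η 0 = 1 ∧ (∀ s, ‖η s‖ ≤ 1) ∧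
    (∀ s : ℝ≥0, 0 < s → 0 < u₂ → ‖η s‖ < 1) ∧
    ∀ u : ℝ≥0, u ≤ u₂ →
      RadialLoewner.Disc.domain V u = connectedComponentIn (ball (0 : ℂ) 1 \ η '' Icc 0 u) 0 ∧
      Tendsto (fun r : ℝ ↦ Function.invFunOn (RadialLoewner.Disc.map V u) (RadialLoewner.Disc.domain V u)
          ((r : ℂ) * Complex.exp ((V u : ℝ) * I)))
        (𝓝[<] 1) (𝓝 (η u))

/-- The simple version implies the plain one. [folklore] -/
theorem LocallyGeneratedSimple.locallyGenerated {V : ℝ≥0 → ℝ} {u₁ : ℝ} (h : LocallyGeneratedSimple V u₁) :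
    LocallyGenerated V u₁ := fun u₂ hu₂ ↦ by
  obtain ⟨η, h1, h2, h3, -, h5⟩ := h u₂ hu₂
  exact ⟨η, h1, h2, h3, h5⟩

/-- **Deterministic reduction, simple phase**: if moreover the chordal generating curve lies in `ℍ`
at positive times, the radial curve `η = toDisc ∘ γ̌ ∘ τ` lies in the open disc at positive times
(`RadialChordal.norm_toDisc_lt_one`, the clock being strictly increasing).
[cite: SchrammWilson2005, §4] -/
theorem locallyGeneratedSimple_of_agree {Y : ℝ → ℝ} {u₁ : ℝ} {V : ℝ≥0 → ℝ} (hu₁ : 0 ≤ u₁)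
    (hY : ContinuousOn Y (Icc 0 u₁)) (hYI : ∀ u ∈ Icc 0 u₁, Y u ∈ Ioo 0 (2 * π))
    (hV : Continuous V) (hV0 : V 0 = 0)
    (hYeq : ∀ u ∈ Icc 0 u₁, Y u = π + (∫ s in (0 : ℝ)..u, Real.cot (Y s / 2)) - V u.toNNReal)
    {Wt : ℝ≥0 → ℝ} (hWt : Continuous Wt)
    (hagree : ∀ s : ℝ≥0, (s : ℝ) ≤ RadialChordal.clock Y u₁ u₁ → Wt s = RadialChordal.cdrv Y u₁ s)
    {γ : ℝ≥0 → ℂ} (hγ : Loewner.IsGeneratedByCurve Wt γ) (hγpos : ∀ t : ℝ≥0, 0 < t → 0 < (γ t).im) :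
    LocallyGeneratedSimple V u₁ := by
  intro u₂ hu₂
  have hagree' : ∀ s : ℝ≥0, s ≤ RadialChordal.clockNN Y u₁ u₂ → Wt s = RadialChordal.cdrv Y u₁ s := by
    intro s hs
    refine hagree s ?_
    have h1 : (s : ℝ) ≤ RadialChordal.clock Y u₁ u₂ := by
      rw [← RadialChordal.coe_clockNN hu₁ hY hYI]; exact_mod_cast hs
    exact h1.trans ((RadialChordal.strictMono_clock hu₁ hY hYI).monotone hu₂.le)
  obtain ⟨h1, h2, h3, h4⟩ := RadialChordal.radialTrace_of_isGeneratedByCurve hu₁ hY hYI hV hV0 hYeq hu₂ hWt hagree' hγ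
  refine ⟨_, h1, h2, h3, fun s hs hu₂' ↦ ?_, h4⟩
  show ‖RadialChordal.toDisc (γ (RadialChordal.clockNN Y u₁ (min s u₂)))‖ < 1
  refine RadialChordal.norm_toDisc_lt_one (hγpos _ ?_)
  have hpos : (0 : ℝ≥0) < min s u₂ := lt_min hs hu₂'
  have h := RadialChordal.clockNN_lt_clockNN hu₁ hY hYI hpos
  rwa [show RadialChordal.clockNN Y u₁ 0 = 0 from by
    rw [← NNReal.coe_eq_zero, RadialChordal.coe_clockNN hu₁ hY hYI, NNReal.coe_zero, RadialChordal.clock_zero]] at h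

/-! ### The flow of a sample as an angle path -/

section Sample

variable {hBc : ∀ ω, Continuous (B · ω)} {n : ℕ} {ε : ℝ} {T : ℝ≥0}

/-- **The band exit precedes the level exit**: the stopped level-`n` flow freezes at an endpoint
`2δₙ` or `2π - 2δₙ`, outside `(2ε, 2π - 2ε)` when `δₙ ≤ ε`. [folklore] -/
theorem bandExit_le_exitLevel (hnε : level n ≤ ε) (ω : Ω) :
    bandExit ε (bmFlow κ B hBc n π) ω ≤ exitLevel (bmDriving κ B) (continuous_bmDriving hBc) n π ω := by
  rcases eq_or_ne (exitLevel (bmDriving κ B) (continuous_bmDriving hBc) n π ω) ⊤ with htop | hne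
  · rw [htop]; exact le_top
  obtain ⟨S, hS⟩ := WithTop.ne_top_iff_exists.1 hne
  rw [← hS]
  have hθ : (π : ℝ) ∈ Ioo (2 * level n) (2 * Real.pi - 2 * level n) := by
    constructor <;> nlinarith [level_pos n, level_le_one n, Real.pi_gt_three]
  have hend := argTrunc_truncExit_eq_or (continuous_bmDriving hBc) (level_pos n) (level_le n) hθ ω hS.symm
  have hXS : bmFlow κ B hBc n π S ω ∉ Ioo (2 * ε) (2 * π - 2 * ε) := by
    have hval : bmFlow κ B hBc n π S ω = argLevel (bmDriving κ B) (continuous_bmDriving hBc) n π S ω := by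
      rw [bmFlow, stoppedProcess_eq_of_le (by rw [← hS])]
    rw [hval]
    rcases hend with h | h
    · rw [show argLevel (bmDriving κ B) (continuous_bmDriving hBc) n π S ω = 2 * level n from h]
      exact fun hm ↦ by linarith [hm.1]
    · rw [show argLevel (bmDriving κ B) (continuous_bmDriving hBc) n π S ω = 2 * Real.pi - 2 * level n from h]
      exact fun hm ↦ by linarith [hm.2]
  exact (Process.exitTime_le_coe_iff (continuous_bmFlow ω)).2 ⟨S, le_rfl, hXS⟩

/-- **The radial Bessel equation of the sample path up to the band exit**: for
`u ≤ u₁ ≤ bandExit ≤ σₙ`, `Y_u = π + ∫₀ᵘ cot(Y_s/2) ds - √κ B_u`. [cite: Lawler2005, §6.4 eq. (6.12)] -/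
theorem flow_eq_integral (hnε : level n ≤ ε) (hB0 : ∀ ω, B 0 ω = 0) {ω : Ω} {u₁ : ℝ}
    (hu₁ : ((u₁.toNNReal : ℝ≥0) : WithTop ℝ≥0) ≤ bandExit ε (bmFlow κ B hBc n π) ω) {u : ℝ} (hu : u ∈ Icc 0 u₁) :
    bmFlow κ B hBc n π u.toNNReal ω = π + (∫ s in (0 : ℝ)..u, Real.cot (bmFlow κ B hBc n π s.toNNReal ω / 2)) -
      bmDriving κ B ω u.toNNReal := by
  have hσ := hu₁.trans (bandExit_le_exitLevel (κ := κ) (hBc := hBc) hnε ω)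
  have hle : ∀ s ∈ Icc 0 u, ((s.toNNReal : ℝ≥0) : WithTop ℝ≥0) ≤
      exitLevel (bmDriving κ B) (continuous_bmDriving hBc) n π ω := fun s hs ↦
    (WithTop.coe_le_coe.2 (Real.toNNReal_le_toNNReal (hs.2.trans hu.2))).trans hσ
  have hval : ∀ s ∈ Icc 0 u, bmFlow κ B hBc n π s.toNNReal ω =
      argLevel (bmDriving κ B) (continuous_bmDriving hBc) n π s.toNNReal ω := fun s hs ↦ by
    rw [bmFlow, stoppedProcess_eq_of_le (hle s hs)]
  have hθ : (π : ℝ) ∈ Ioo (2 * level n) (2 * Real.pi - 2 * level n) := by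
    constructor <;> nlinarith [level_pos n, level_le_one n, Real.pi_gt_three]
  rw [hval u ⟨hu.1, le_rfl⟩]
  show argTrunc (bmDriving κ B) (level n) (continuous_bmDriving hBc) (level_pos n) (level_le n) π u.toNNReal ω = _
  have h := argTrunc_eq_integral (t := u.toNNReal) (continuous_bmDriving (κ := κ) hBc) (level_pos n) (level_le n) π ω
  rw [Real.coe_toNNReal _ hu.1] at h
  have hU0 : bmDriving κ B ω 0 = 0 := by simp [bmDriving, hB0]
  rw [hU0, sub_zero] at h
  rw [h]
  congr 1
  congr 1
  refine intervalIntegral.integral_congr fun s hs ↦ ?_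
  rw [uIcc_of_le hu.1] at hs
  have hband := bmFlow_mem_Icc (κ := κ) (B := B) (hBc := hBc) hθ s.toNNReal ω
  rw [hval s hs] at hband
  show cotTrunc (level n) (argTrunc (bmDriving κ B) (level n) (continuous_bmDriving hBc) (level_pos n) (level_le n) π
    s.toNNReal ω / 2) = Real.cot (bmFlow κ B hBc n π s.toNNReal ω / 2)
  rw [hval s hs]
  refine cotTrunc_eq_cot ⟨?_, ?_⟩
  · linarith [hband.1]
  · linarith [hband.2]

/-- **The concatenated, time-changed driver agrees with the pathwise chordal driver** up to the
clock of the horizon `r`: if `Y = swMart` and `c = clockProc / Q₀²` up to `r ≤ T`, `Ỹ_{c_t} = Y_t`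
for `t ≤ r` (time change undone) and `M = Ỹ` up to the total clock `c_r` (concatenation), then
`L M_{s/Q₀²} = cdrv s` for `s ≤ clock r`, `L = √(κ Q₀²)`. [cite: SchrammWilson2005, §4 Thm. 3] -/
theorem driver_agree {X : ℝ≥0 → Ω → ℝ} {a : ℝ} {T : ℝ≥0} {κ : ℝ≥0} {ω : Ω} {r : ℝ≥0}
    (hκ : 0 < κ) (ha : 0 < a) (ha' : a ≤ π) (hband : ∀ s, X s ω ∈ Icc a (2 * π - a)) (hX0 : X 0 ω = π)
    (hXc : Continuous (X · ω)) (hrT : r ≤ T)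
    {Y : ℝ≥0 → Ω → ℝ} (hYval : ∀ t : ℝ≥0, t ≤ r → Y t ω = swMart κ a T X t ω)
    {c : ℝ≥0 → Ω → ℝ} (hcval : ∀ t : ℝ≥0, t ≤ r → c t ω = clockProc a T X t ω / rateBound a ^ 2)
    {Yt : ℝ≥0 → ℝ} (hYt : ∀ t : ℝ≥0, t ≤ r → Yt (c t ω).toNNReal = Y t ω)
    {Mw : ℝ≥0 → ℝ} (hMw : ∀ s' : ℝ≥0, (s' : ℝ) ≤ clockProc a T X r ω / rateBound a ^ 2 → Mw s' = Yt s')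
    (s : ℝ≥0) (hs : (s : ℝ) ≤ RadialChordal.clock (fun u ↦ X u.toNNReal ω) r r) :
    Real.sqrt (κ * rateBound a ^ 2) * Mw (((rateBound a ^ 2).toNNReal)⁻¹ * s) =
      RadialChordal.cdrv (fun u ↦ X u.toNNReal ω) r s := by
  set K : ℝ := rateBound a ^ 2 with hKdef
  have hQ₀ : 0 < rateBound a := by
    rw [rateBound]; have := Real.sin_pos_of_pos_of_lt_pi (by linarith : 0 < a / 2) (by linarith); positivity
  have hK : 0 < K := by positivity
  have hKnn : (K.toNNReal : ℝ) = K := Real.coe_toNNReal _ hK.le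
  set L : ℝ := Real.sqrt (κ * rateBound a ^ 2) with hLdef
  have hL : 0 < L := Real.sqrt_pos.2 (mul_pos (by exact_mod_cast hκ) hK)
  set Yp : ℝ → ℝ := fun u ↦ X u.toNNReal ω with hYp
  have hu₁ : (0 : ℝ) ≤ r := r.coe_nonneg
  have hrT' : (r : ℝ) ≤ T := by exact_mod_cast hrT
  have hYcont : ContinuousOn Yp (Icc 0 r) := (hXc.comp continuous_real_toNNReal).continuousOn
  have hYI : ∀ u ∈ Icc (0 : ℝ) r, Yp u ∈ Ioo 0 (2 * π) := fun u _ ↦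
    ⟨by linarith [(hband u.toNNReal).1], by linarith [(hband u.toNNReal).2]⟩
  have hclock_eq : ∀ u ∈ Icc (0 : ℝ) r, clockProc a T X u.toNNReal ω = RadialChordal.clock Yp r u := fun u hu ↦
    clockProc_eq_clock hband hrT' hu
  have hrnn : (r : ℝ).toNNReal = r := Real.toNNReal_coe
  -- the inverse radial clock of `s`
  set u : ℝ := RadialChordal.invClock Yp r s with hudef
  have hclock0 : RadialChordal.clock Yp r 0 = 0 := RadialChordal.clock_zero
  have hsmem : (s : ℝ) ∈ Icc 0 (RadialChordal.clock Yp r r) := ⟨s.coe_nonneg, hs⟩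
  have humem : u ∈ Icc (0 : ℝ) r := RadialChordal.invClock_mem_Icc hu₁ hYcont hYI hsmem
  have hmono := (RadialChordal.strictMono_clock hu₁ hYcont hYI).monotone
  have hcu : RadialChordal.clock Yp r u = s := by
    refine RadialChordal.clock_invClock_of_mem hu₁ hYcont hYI ⟨?_, ?_⟩
    · exact (hmono (by norm_num : (-1 : ℝ) ≤ 0)).trans (hclock0.le.trans hsmem.1)
    · exact hsmem.2.trans (hmono (by linarith))
  have hule : u.toNNReal ≤ r := by rw [← hrnn]; exact Real.toNNReal_le_toNNReal humem.2
  -- the concatenated driver at `s/K` is `Ỹ_{s/K} = Y_u = W_u / L`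
  have hsK : (((K.toNNReal)⁻¹ * s : ℝ≥0) : ℝ) ≤ clockProc a T X r ω / rateBound a ^ 2 := by
    rw [NNReal.coe_mul, NNReal.coe_inv, hKnn, inv_mul_eq_div, ← hrnn, hclock_eq r ⟨hu₁, le_rfl⟩]
    exact div_le_div_of_nonneg_right hs hK.le
  have hcval' : c u.toNNReal ω = (((K.toNNReal)⁻¹ * s : ℝ≥0) : ℝ) := by
    rw [hcval _ hule, hclock_eq u humem, hcu, NNReal.coe_mul, NNReal.coe_inv, hKnn, inv_mul_eq_div]
  have h1 : Mw ((K.toNNReal)⁻¹ * s) = Y u.toNNReal ω := by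
    rw [hMw _ hsK, ← hYt _ hule, hcval', Real.toNNReal_coe]
  rw [h1, hYval _ hule, swMart, wProc_zero_of_eq_pi (T := T) ha' hX0, sub_zero, ← hLdef,
    wProc_eq_drv hband hrT' humem, mul_div_cancel₀ _ hL.ne', RadialChordal.cdrv]

end Sample

/-! ### The theorem -/

section Main

variable {hBm : ∀ t, Measurable (B t)} {hBc : ∀ ω, Continuous (B · ω)}

/-- The radial horizon `ρ = S ∧ T` (band exit of the stopped flow, capped at `T`) as a finite
time. [folklore] -/
def horizon (κ : ℝ≥0) (B : ℝ≥0 → Ω → ℝ) (hBc : ∀ ω, Continuous (B · ω)) (n : ℕ) (ε : ℝ) (T : ℝ≥0) (ω : Ω) : ℝ≥0 :=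
  (min (T : WithTop ℝ≥0) (bandExit ε (bmFlow κ B hBc n π) ω)).untopA

/-- `↑ρ = T ∧ S`. [folklore] -/
theorem coe_horizon (n : ℕ) (ε : ℝ) (T : ℝ≥0) (ω : Ω) :
    (horizon κ B hBc n ε T ω : WithTop ℝ≥0) = min (T : WithTop ℝ≥0) (bandExit ε (bmFlow κ B hBc n π) ω) :=
  coe_untopA_min T _

/-- `ρ ≤ T`. [folklore] -/
theorem horizon_le (n : ℕ) (ε : ℝ) (T : ℝ≥0) (ω : Ω) : horizon κ B hBc n ε T ω ≤ T := untopA_min_le T _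

/-- `↑ρ ≤ S`. [folklore] -/
theorem coe_horizon_le_bandExit (n : ℕ) (ε : ℝ) (T : ℝ≥0) (ω : Ω) :
    (horizon κ B hBc n ε T ω : WithTop ℝ≥0) ≤ bandExit ε (bmFlow κ B hBc n π) ω := by
  rw [coe_horizon]; exact min_le_right _ _

set_option maxHeartbeats 400000 in
/-- **Transfer of almost sure properties of the chordal trace to the radial chain of every Brownian
motion** (the Schramm–Wilson pull-back, abstract form). Let `Φ` be a property of chordal generating
curves that holds almost surely for the chain of `√κ B'`, for every Brownian motion `B'` with
continuous paths on the product space `Ω × C` (e.g. "generated by a curve", Rohde–Schramm Thm. 5.1,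
or "simple", Thm. 6.1, `κ ≤ 4`), and let `Ψ V u₁` be a property of radial driving functions that
follows deterministically from the Schramm–Wilson data of an angle path together with a chordal
driver agreeing with `cdrv` up to the clock of `u₁` and generated by a `Φ`-curve (e.g.
`LocallyGenerated`, `locallyGenerated_of_agree`). Then for every real Brownian motion `B` with
continuous paths (`B₀ = 0`) on any probability space, almost surely `Ψ (√κ B) ρ` up to the radial
horizon `ρ = S ∧ T` (`horizon`). Proof: the stopped flow `Y` of the marked point solves the
`(κ, 0)` angle martingale problem (`martingale_angleMP_bmFlow`); tilt to `(κ, κ − 6)`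
(`exists_tilted_measure_target`, `Q ~ P`); under `Q` the chordal driver `W = R + 𝒴 cot(Y/2)` has
the martingale clock `κ τ` (`SchrammWilson.hasMartingaleClock_swMart`); time change by the inverse
clock (`HasMartingaleClock.timeChange`) and concatenation with an independent Brownian motion
(`isBrownianReal_concat`) give `√κ ×` a Brownian motion on `Ω × C` agreeing with the pathwise
chordal driver up to the clock of `ρ` (`driver_agree`); its trace has `Φ` a.s.; the conclusion
involves only `ω`, so it transfers from `Q ⊗ W`-a.e. to `P`-a.e. [cite: SchrammWilson2005, §4 Thm. 3] -/
theorem ae_of_chordal [IsProbabilityMeasure P] (hB : IsBrownianReal B P)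
    (hBm : ∀ t, Measurable (B t)) (hBc : ∀ ω, Continuous (B · ω)) (hB0 : ∀ ω, B 0 ω = 0)
    (hκ : 0 < κ) {n : ℕ} {ε : ℝ} (hε : 0 < ε) (hε2 : ε < π / 2) (hnε : 2 * level n < ε / 2)
    (T : ℝ≥0) (Φ : (ℝ≥0 → ℂ) → Prop)
    (hΦ : ∀ (P' : Measure (Ω × (ℝ≥0 → ℝ))) [IsProbabilityMeasure P'] (B' : ℝ≥0 → Ω × (ℝ≥0 → ℝ) → ℝ),
      IsBrownianReal B' P' → (∀ t, Measurable (B' t)) → (∀ p, Continuous (B' · p)) →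
        ∀ᵐ p ∂P', ∃ γ : ℝ≥0 → ℂ, Loewner.IsGeneratedByCurve (fun s ↦ Real.sqrt κ * B' s p) γ ∧ Φ γ)
    (Ψ : (ℝ≥0 → ℝ) → ℝ → Prop)
    (hΨ : ∀ {Y : ℝ → ℝ} {u₁ : ℝ} {V : ℝ≥0 → ℝ}, 0 ≤ u₁ → ContinuousOn Y (Icc 0 u₁) →
      (∀ u ∈ Icc 0 u₁, Y u ∈ Ioo 0 (2 * π)) → Continuous V → V 0 = 0 →
      (∀ u ∈ Icc 0 u₁, Y u = π + (∫ s in (0 : ℝ)..u, Real.cot (Y s / 2)) - V u.toNNReal) →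
      ∀ {Wt : ℝ≥0 → ℝ}, Continuous Wt →
      (∀ s : ℝ≥0, (s : ℝ) ≤ RadialChordal.clock Y u₁ u₁ → Wt s = RadialChordal.cdrv Y u₁ s) →
      ∀ {γ : ℝ≥0 → ℂ}, Loewner.IsGeneratedByCurve Wt γ → Φ γ → Ψ V u₁) :
    ∀ᵐ ω ∂P, Ψ (bmDriving κ B ω) (horizon κ B hBc n ε T ω) := by
  -- the setting
  set a : ℝ := 2 * level n with hadef
  have ha : 0 < a := by rw [hadef]; linarith [level_pos n]
  have ha' : a ≤ π := by rw [hadef]; linarith [level_le n, Real.pi_pos]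
  have hεπ : ε < π := by linarith [Real.pi_pos]
  have hnε' : level n ≤ ε := by linarith [level_pos n]
  have hθ : (π : ℝ) ∈ Ioo (2 * level n) (2 * Real.pi - 2 * level n) := by
    constructor <;> nlinarith [level_pos n, level_le_one n, Real.pi_gt_three]
  set X : ℝ≥0 → Ω → ℝ := bmFlow κ B hBc n π with hXdef
  set 𝓕 := bmFiltration κ B hBm with h𝓕def
  have hXprog : IsStronglyProgressive 𝓕 X := isStronglyProgressive_bmFlow hBm
  have hXc : ∀ ω, Continuous (X · ω) := fun ω ↦ continuous_bmFlow ω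
  have hXband : ∀ t ω, X t ω ∈ Icc a (2 * π - a) := fun t ω ↦ bmFlow_mem_Icc hθ t ω
  have hX0 : ∀ ω, X 0 ω = π := fun ω ↦ bmFlow_zero ω
  -- Step 1: the `(κ, 0)` martingale problem and the tilt to `(κ, κ - 6)`
  have hMP0 : ∀ F : ℝ → ℝ, ContDiff ℝ 2 F → tsupport F ⊆ Icc (ε / 2) (2 * π - ε / 2) →
      Martingale (fun (t : ℝ≥0) ω ↦ F (X t ω) - F (X 0 ω) -
        timeIntegral (fun s ω ↦ angleGenerator κ (0 : ℝ) F (X s ω)) t ω) 𝓕 P := fun F hF hs ↦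
    martingale_angleMP_bmFlow hB hBm hBc hθ hF (hs.trans (Icc_subset_Ioo (by linarith) (by linarith)))
  obtain ⟨Q, hQ, hPQ, hQP, hMPQ⟩ := exists_tilted_measure_target (0 : ℝ) ((κ : ℝ) - 6) hκ hXprog hXc hε hεπ hMP0 T
  haveI := hQ
  haveI := isProbabilityMeasure_preWienerMeasure'
  -- Step 2: the Schramm–Wilson clock under `Q`
  have hclock := SchrammWilson.hasMartingaleClock_swMart (Q := Q) hκ hXprog hXc ha ha' hXband hε hε2 T hMPQ
  set τ := bandExit ε X with hτdef
  have hτst : IsStoppingTime 𝓕 τ := Process.isStoppingTime_exitTime (fun t ↦ (hXprog.stronglyAdapted t).measurable) hXc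
  set Y : ℝ≥0 → Ω → ℝ := stoppedProcess (swMart κ a T X) τ with hYdef
  set c : ℝ≥0 → Ω → ℝ := swClock a T ε X with hcdef
  set K : ℝ := rateBound a ^ 2 with hKdef
  have hQ₀ : 0 < rateBound a := by rw [rateBound]; have := Real.sin_pos_of_pos_of_lt_pi (by linarith : 0 < a / 2) (by linarith); positivity
  have hK : 0 < K := by positivity
  set L : ℝ := Real.sqrt (κ * rateBound a ^ 2) with hLdef
  have hκK : 0 < (κ : ℝ) * K := mul_pos (by exact_mod_cast hκ) hK
  have hL : 0 < L := Real.sqrt_pos.2 hκK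
  -- Step 3: the time change
  have hswprog : IsStronglyProgressive 𝓕 (swMart κ a T X) := isStronglyProgressive_swMart hXprog ha ha' κ T
  have hYad : StronglyAdapted 𝓕 Y := hswprog.stronglyAdapted_stoppedProcess hτst
  have hYc : ∀ ω, Continuous (Y · ω) := fun ω ↦
    continuous_stoppedProcess_apply (continuous_swMart (κ := κ) (T := T) ha ha' hXc ω) τ
  have hclprog : IsStronglyProgressive 𝓕 (clockProc a T X) := isStronglyProgressive_clockProc hXprog ha ha' T
  have hcad : Adapted 𝓕 c := fun t ↦ by
    show Measurable[𝓕 t] fun ω ↦ stoppedProcess (clockProc a T X) τ t ω / rateBound a ^ 2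
    exact ((hclprog.stronglyAdapted_stoppedProcess hτst) t).measurable.div_const _
  set ρ : Ω → ℝ≥0 := horizon κ B hBc n ε T with hρdef
  have hρcoe : ∀ ω, (ρ ω : WithTop ℝ≥0) = min (T : WithTop ℝ≥0) (τ ω) := fun ω ↦ coe_horizon n ε T ω
  have hρ : IsStoppingTime 𝓕 fun ω ↦ (ρ ω : WithTop ℝ≥0) := by
    have heq : (fun ω ↦ (ρ ω : WithTop ℝ≥0)) = fun ω ↦ min (τ ω) (T : WithTop ℝ≥0) := by
      funext ω; rw [hρcoe, min_comm]
    rw [heq]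
    exact hτst.min_const T
  have hρT : ∀ ω, ρ ω ≤ T := fun ω ↦ horizon_le n ε T ω
  have hρτ : ∀ ω, (ρ ω : WithTop ℝ≥0) ≤ τ ω := fun ω ↦ coe_horizon_le_bandExit n ε T ω
  -- the clock is `clockProc (t ∧ ρ) / K`
  have hcformula : ∀ (t : ℝ≥0) ω, c t ω = clockProc a T X (min t (ρ ω)) ω / K := by
    intro t ω
    show clockProc a T X ((min (t : WithTop ℝ≥0) (τ ω)).untopA) ω / rateBound a ^ 2 = _
    congr 1
    set x := min (t : WithTop ℝ≥0) (τ ω) with hx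
    have hxc : ((x.untopA : ℝ≥0) : WithTop ℝ≥0) = x := coe_untopA_min t (τ ω)
    rw [clockProc_eq_min x.untopA ω]
    congr 1
    apply WithTop.coe_injective
    rw [WithTop.coe_min, WithTop.coe_min, hxc, hρcoe, hx, min_assoc, min_comm (τ ω)]
  have hc_of_le : ∀ ω (t : ℝ≥0), t ≤ ρ ω → c t ω = clockProc a T X t ω / K := by
    intro ω t ht; rw [hcformula, min_eq_left ht]
  have hfrozen : ∀ t ω, c t ω = c (min t (ρ ω)) ω := by
    intro t ω; rw [hcformula, hcformula, min_assoc, min_self]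
  have hstrict : ∀ ω, StrictMonoOn (fun t ↦ c t ω) (Icc 0 (ρ ω)) := by
    intro ω s hs t ht hst
    show c s ω < c t ω
    rw [hc_of_le ω s hs.2, hc_of_le ω t ht.2]
    exact div_lt_div_of_pos_right (strictMonoOn_clockProc (T := T) ha ha' hXc ω
      ⟨hs.1, hs.2.trans (hρT ω)⟩ ⟨ht.1, ht.2.trans (hρT ω)⟩ hst) hK
  have htc := hclock.timeChange hYad hYc hcad hρ hρT hfrozen
  have hcc := hclock.continuous_clock
  have hc0 := hclock.clock_zero
  have hmono := hclock.monotone_clock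
  set 𝒢 := tcFiltration hcad hcc hρ with h𝒢def
  -- Step 4: concatenation with an independent Brownian motion
  set σ : Ω → ℝ≥0 := fun ω ↦ (totalClock c ρ ω).toNNReal with hσdef
  have hσ0 : ∀ ω, 0 ≤ totalClock c ρ ω := fun ω ↦ hclock.clock_nonneg ω _
  have hσcoe : ∀ ω, ((σ ω : ℝ≥0) : ℝ) = totalClock c ρ ω := fun ω ↦ Real.coe_toNNReal _ (hσ0 ω)
  have hmin_eq : ∀ (s : ℝ≥0) ω, min (s : ℝ) (totalClock c ρ ω) = ((min s (σ ω) : ℝ≥0) : ℝ) := by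
    intro s ω; rw [NNReal.coe_min, hσcoe]
  have htc' : HasMartingaleClock (tcProc Y c ρ) (fun s ω ↦ ((min s (σ ω) : ℝ≥0) : ℝ)) 𝒢 Q
      (2 * (T * (1 / (2 * Real.sin (a / 2) ^ 3)) + 1 / Real.sin (a / 2)) / Real.sqrt (κ * rateBound a ^ 2)) := by
    have heq : (fun (s : ℝ≥0) ω ↦ ((min s (σ ω) : ℝ≥0) : ℝ)) = fun (s : ℝ≥0) ω ↦ min (s : ℝ) (totalClock c ρ ω) := by
      funext s ω; exact (hmin_eq s ω).symm
    rw [heq]; exact htc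
  have hYprog : IsStronglyProgressive 𝓕 Y := hYad.isStronglyProgressive_of_continuous hYc
  have hcontY : ∀ ω, Continuous fun s ↦ tcProc Y c ρ s ω := continuous_tcProc hYc hc0 hcc hmono hstrict
  have hYad' : ∀ s, StronglyMeasurable[𝒢 s] (tcProc Y c ρ s) := fun s ↦
    (measurable_tcProc hcad hcc hρ hYprog s).stronglyMeasurable
  have hσm : Measurable σ := (measurable_totalClock hcad hcc hρ).real_toNNReal
  have hcad' : ∀ s : ℝ≥0, Measurable[𝒢 s] fun ω ↦ min s (σ ω) := by
    intro s
    have h1 := (measurable_min_totalClock hcad hcc hρ hc0 hmono hfrozen s).real_toNNReal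
    have heq : (fun ω ↦ (min (s : ℝ) (totalClock c ρ ω)).toNNReal) = fun ω ↦ min s (σ ω) := by
      funext ω; rw [hmin_eq, Real.toNNReal_coe]
    rwa [heq] at h1
  have hY0 : ∀ ω, tcProc Y c ρ 0 ω = 0 := fun ω ↦ by
    rw [tcProc_zero hc0]
    show stoppedProcess (swMart κ a T X) τ 0 ω = 0
    simp [stoppedProcess, swMart]
  set M : ℝ≥0 → Ω × (ℝ≥0 → ℝ) → ℝ := fun s p ↦ tcProc Y c ρ s p.1 +
    (Process.brownian s p.2 - Process.brownian (min s (σ p.1)) p.2) with hMdef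
  have hBM : IsBrownianReal M (Q.prod Process.preWienerMeasure) :=
    isBrownianReal_concat htc' hcontY hYad' hσm hcad' hY0 rfl
  have hMc : ∀ p, Continuous (M · p) := continuous_concat rfl hcontY
  -- Step 5: Brownian scaling to the chordal driver `U = √κ B̌`, `B̌_t = √K M_{t/K}`
  set cK : ℝ≥0 := (K.toNNReal)⁻¹ with hcKdef
  have hKnn : (K.toNNReal : ℝ) = K := Real.coe_toNNReal _ hK.le
  have hcK0 : cK ≠ 0 := inv_ne_zero (by rw [← NNReal.coe_ne_zero, hKnn]; exact hK.ne')
  set Bc : ℝ≥0 → Ω × (ℝ≥0 → ℝ) → ℝ := fun t p ↦ (√(cK : ℝ))⁻¹ * M (cK * t) p with hBcdef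
  have hBcBM : IsBrownianReal Bc (Q.prod Process.preWienerMeasure) := hBM.smul hcK0
  have hBcc : ∀ p, Continuous (Bc · p) := fun p ↦
    continuous_const.mul ((hMc p).comp (continuous_const.mul continuous_id))
  have hMm : ∀ t, Measurable (M t) := measurable_concat hMdef hYad' hcad'
  have hBcm : ∀ t, Measurable (Bc t) := fun t ↦ (hMm _).const_mul _
  have hgen := hΦ _ Bc hBcBM hBcm hBcc
  -- `√κ B̌_s = L M_{s/K}`
  have hsqrt : (√(cK : ℝ))⁻¹ = Real.sqrt K := by
    rw [hcKdef, NNReal.coe_inv, hKnn, Real.sqrt_inv, inv_inv]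
  have hLK : L = Real.sqrt κ * Real.sqrt K := by rw [hLdef, ← hKdef, Real.sqrt_mul (NNReal.coe_nonneg κ)]
  have hU : ∀ (s : ℝ≥0) p, Real.sqrt κ * Bc s p = L * M (cK * s) p := by
    intro s p; rw [hBcdef]; simp only; rw [hsqrt, hLK]; ring
  -- Step 6: the deterministic identification, for a good sample `(ω, ω')`
  have hdet : ∀ p : Ω × (ℝ≥0 → ℝ),
      (∃ γ : ℝ≥0 → ℂ, Loewner.IsGeneratedByCurve (fun s ↦ Real.sqrt κ * Bc s p) γ ∧ Φ γ) →
      Ψ (bmDriving κ B p.1) (ρ p.1) := by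
    rintro ⟨ω, ω'⟩ ⟨γ, hγ, hΦγ⟩
    have hband : ∀ s, X s ω ∈ Icc a (2 * π - a) := fun s ↦ hXband s ω
    have hrT' : ((ρ ω : ℝ≥0) : ℝ) ≤ T := by exact_mod_cast hρT ω
    have hrnn : ((ρ ω : ℝ≥0) : ℝ).toNNReal = ρ ω := Real.toNNReal_coe
    have hYcont : ContinuousOn (fun u ↦ X u.toNNReal ω) (Icc 0 (ρ ω : ℝ)) :=
      ((hXc ω).comp continuous_real_toNNReal).continuousOn
    have hYI : ∀ u ∈ Icc (0 : ℝ) (ρ ω : ℝ), (fun u ↦ X u.toNNReal ω) u ∈ Ioo 0 (2 * π) := fun u _ ↦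
      ⟨by linarith [(hband u.toNNReal).1], by linarith [(hband u.toNNReal).2]⟩
    have hV : Continuous (bmDriving κ B ω) := continuous_bmDriving hBc ω
    have hV0 : bmDriving κ B ω 0 = 0 := by simp [bmDriving, hB0]
    have hYeq : ∀ u ∈ Icc (0 : ℝ) (ρ ω : ℝ), (fun u ↦ X u.toNNReal ω) u =
        π + (∫ s in (0 : ℝ)..u, Real.cot ((fun u ↦ X u.toNNReal ω) s / 2)) - bmDriving κ B ω u.toNNReal := by
      intro u hu
      exact flow_eq_integral hnε' hB0 (by rw [hrnn]; exact hρτ ω) hu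
    -- the hypotheses of `driver_agree`
    have hYval : ∀ t : ℝ≥0, t ≤ ρ ω → Y t ω = swMart κ a T X t ω := fun t ht ↦
      stoppedProcess_eq_of_le ((WithTop.coe_le_coe.2 ht).trans (hρτ ω))
    have hYt : ∀ t : ℝ≥0, t ≤ ρ ω → tcProc Y c ρ (c t ω).toNNReal ω = Y t ω := fun t ht ↦
      tcProc_clock (Y := Y) hcc hstrict (fun t ω ↦ hclock.clock_nonneg ω t) ht
    have hMw : ∀ s' : ℝ≥0, (s' : ℝ) ≤ clockProc a T X (ρ ω) ω / rateBound a ^ 2 →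
        M s' (ω, ω') = tcProc Y c ρ s' ω := by
      intro s' hs'
      have hle : s' ≤ σ ω := by
        rw [← NNReal.coe_le_coe, hσcoe, totalClock, hc_of_le ω (ρ ω) le_rfl]
        exact hs'
      exact concat_eq_of_le (M := M) (Y := tcProc Y c ρ) (σ := σ) hMdef hle
    have hagree : ∀ s : ℝ≥0, (s : ℝ) ≤ RadialChordal.clock (fun u ↦ X u.toNNReal ω) (ρ ω) (ρ ω) →
        Real.sqrt κ * Bc s (ω, ω') = RadialChordal.cdrv (fun u ↦ X u.toNNReal ω) (ρ ω) s := by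
      intro s hs
      rw [hU]
      exact driver_agree hκ ha ha' hband (hX0 ω) (hXc ω) (hρT ω) hYval (fun t ht ↦ hc_of_le ω t ht) hYt hMw s hs
    exact hΨ (ρ ω).coe_nonneg hYcont hYI hV hV0 hYeq (continuous_const.mul (hBcc (ω, ω'))) hagree hγ hΦγ
  -- Step 7: from `Q ⊗ W`-a.e. to `P`-a.e.
  have hae : ∀ᵐ p ∂Q.prod Process.preWienerMeasure, Ψ (bmDriving κ B p.1) (ρ p.1) := by
    filter_upwards [hgen] with p hp using hdet p hp
  have hQae : ∀ᵐ ω ∂Q, Ψ (bmDriving κ B ω) (ρ ω) := by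
    have h2 := Measure.ae_ae_of_ae_prod hae
    filter_upwards [h2] with ω hω
    haveI : (ae Process.preWienerMeasure).NeBot := ae_neBot.2 (IsProbabilityMeasure.ne_zero _)
    exact hω.exists.choose_spec
  exact hPQ.ae_le hQae

/-- **Radial SLE_κ is locally generated by a curve, for every Brownian motion** (`κ ∉ {0, 8}`).
Let `B` be a real Brownian motion with continuous paths (`B₀ = 0`) on any probability space, and
`V = √κ B` the radial driving function. Then almost surely the radial Loewner chain of `V` is
generated by a continuous curve with tips (`LocallyGenerated`) up to the radial horizon
`ρ = S ∧ T` (`ae_of_chordal` with Rohde–Schramm's Thm. 5.1 for a general Brownian motion,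
`ae_isGeneratedByCurve_of_isBrownianReal`, and `locallyGenerated_of_agree`).
[cite: Lawler2005, §6.5 Prop. 6.21] -/
theorem ae_locallyGenerated [IsProbabilityMeasure P] (hB : IsBrownianReal B P)
    (hBm : ∀ t, Measurable (B t)) (hBc : ∀ ω, Continuous (B · ω)) (hB0 : ∀ ω, B 0 ω = 0)
    (hκ : 0 < κ) (h8 : κ ≠ 8) {n : ℕ} {ε : ℝ} (hε : 0 < ε) (hε2 : ε < π / 2) (hnε : 2 * level n < ε / 2)
    (T : ℝ≥0) :
    ∀ᵐ ω ∂P, LocallyGenerated (bmDriving κ B ω) (horizon κ B hBc n ε T ω) :=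
  ae_of_chordal hB hBm hBc hB0 hκ hε hε2 hnε T (fun _ ↦ True)
    (fun P' _ B' hB' _ hB'c ↦ by
      filter_upwards [ae_isGeneratedByCurve_of_isBrownianReal hB' hB'c hκ.ne' h8] with p ⟨γ, hγ⟩
      exact ⟨γ, hγ, trivial⟩)
    LocallyGenerated
    (fun hu₁ hY hYI hV hV0 hYeq _ hWt hagree _ hγ _ ↦ locallyGenerated_of_agree hu₁ hY hYI hV hV0 hYeq hWt hagree hγ)

/-- **Radial SLE_κ, `κ ≤ 4`, is locally generated by a curve inside the disc, for every Brownian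
motion**: as `ae_locallyGenerated`, and the curve does not touch the unit circle at positive times
(`LocallyGeneratedSimple`; chordal input Rohde–Schramm Thm. 6.1 for a general Brownian motion,
`ae_isSimpleTrace_of_isBrownianReal`; Lawler (2005), §6.4: radial SLE_κ swallows no boundary point
for `κ ≤ 4`). [cite: Lawler2005, §6.5 Prop. 6.21] -/
theorem ae_locallyGeneratedSimple [IsProbabilityMeasure P] (hB : IsBrownianReal B P)
    (hBm : ∀ t, Measurable (B t)) (hBc : ∀ ω, Continuous (B · ω)) (hB0 : ∀ ω, B 0 ω = 0)
    (hκ : 0 < κ) (hκ4 : κ ≤ 4) {n : ℕ} {ε : ℝ} (hε : 0 < ε) (hε2 : ε < π / 2) (hnε : 2 * level n < ε / 2)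
    (T : ℝ≥0) :
    ∀ᵐ ω ∂P, LocallyGeneratedSimple (bmDriving κ B ω) (horizon κ B hBc n ε T ω) :=
  ae_of_chordal hB hBm hBc hB0 hκ hε hε2 hnε T (fun γ ↦ ∀ t : ℝ≥0, 0 < t → 0 < (γ t).im)
    (fun P' _ B' hB' hB'm hB'c ↦ by
      filter_upwards [ae_isSimpleTrace_of_isBrownianReal hB' hB'm hB'c hκ hκ4] with p ⟨γ, hγ, hs⟩
      exact ⟨γ, hγ, hs.2⟩)
    LocallyGeneratedSimple
    (fun hu₁ hY hYI hV hV0 hYeq _ hWt hagree _ hγ hpos ↦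
      locallyGeneratedSimple_of_agree hu₁ hY hYI hV hV0 hYeq hWt hagree hγ hpos)

end Main

end RadialSLE

end Literature.Probability.RandomPlanarGeometry
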